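import Literature.Probability.RandomPlanarGeometry.HexSAWPolygonSupermult
import HarnessLib

/-!
# «Tall third» for honeycomb polygons: at least a third of the rooted self-avoiding `N`-loops of `ℍ`, of the translation classes
# counted by `q_N(ℍ)`, and of the canonical traversals `canonEnd n`, visit at least `√(N/2)` distinct rows
# (stub S1ℍ of a Madras-type `√N`-gain join on `ℍ`; the order-3 rotation replaces the `x ↔ y` symmetry of `ℤ²`)

Topic `Literature/Probability/RandomPlanarGeometry` (lane «pcv-sawmu», a-p4 g12, LINE «HEX-MADRAS» (`q_N(ℍ) ≤ A N^{−1/2} μ_ℍ^N`, design note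
`DESIGN-hex-madras-sqrtN.md`, analytic consumer `HexSAWPolygonMadrasBootstrap.lean`); continues `HexSAWPolygonNumber.lean` (`HexBW.saLoops N`:
the rooted oriented self-avoiding `N`-loops of the brick wall at `0`, `card_saLoops_eq_mul_hexPolygonNumber : #saLoops N = N · q_N(ℍ)`,
`isBW_unroot_iff`, `parity_of_mem_zdSaLoops`), `SAWPolygonUnrooting.lean` (`Zd.PolygonConcat.unroot`/`unrootDom`/`card_filter_saLoops_eq`),
`HexSAWPolygonSupermult.lean` (`canonEnd n`, `card_canonEnd`, `hexPolygonNumber_eq_zero_of_odd`, `not_isBWShift_e0_of_mem_polygonReps`,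
`apply_pred_of_mem_polygonReps`) and `SAWBrickWallHex.lean` (`brickWallGraph`, `brickWallGraph_adj_coord`); the `𝕋` twin is
`SAWTriangularPolygonTallThird.lean` (a-p4 g9).

Source of the scheme: N. Madras, *A rigorous bound on the critical exponent for the number of lattice trees, animals, and polygons*,
J. Stat. Phys. 78 (1995) 681–699, §2 (primary; not held by the lane — on `ℤ²`: at least half of the polygons are at least as tall as wide, by
the symmetry exchanging the coordinates; a tall polygon through `N` sites occupies at least `√N` rows); printed in the secondary source
A. Hammond, arXiv:1504.05286v5, Definition 4.8 and Lemma 4.9 pp. 24–25 ("h(φ) ≥ w(φ) … by right-angled rotation; h(φ) ≥ n^{1/2}").  On the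
honeycomb lattice in the brick-wall frame (`brickWallGraph`: horizontal bonds everywhere, the vertical bond `{(x,y),(x,y+1)}` present iff
`x + y` is even) there is no coordinate swap; instead the ROTATION BY 120° about the origin vertex — in brick-wall coordinates
`ρ(x, y) = (⌊(x+y)/2⌋ + 2⌊(y−x)/2⌋ + ((x+y) mod 2), −⌊(x+y)/2⌋)` (it is `hvToBW ∘ HV.rho ∘ bwToHV` for the tree's `HV.rho` of
`HexSAWRotStripDictionary.lean`, written out so that this file imports only the polygon numbers) — is a graph automorphism of order 3
fixing `0`; the rows of `ρ(ω)` are the second family of zigzag lines of `ω` and those of `ρ²(ω)` the third, so at least a THIRD of the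
loops have their largest zigzag count along the rows, and that count `e` satisfies `N ≤ 2e²` since a row and a rotated row meet in at most
two sites.  The counts are CLASS functions because re-rooting a honeycomb polygon inside the brick wall translates its site set by an EVEN
vector `t`, and `ρ(x + t) = ρ(x) + ρ(t)` for even `t`.

## What is proved (namespace `…SAW.HexBW`; all `theorem`s, axioms standard)

Rooted level:
* `bwRot` (+ `bwRot_zero`, `bwRot_adj`, `bwRot_bwRot_bwRot`, `bwRot_injective`, `eq_of_rows_eq`, `bwRot_add_of_even`): the rotation in brick-wall
  coordinates; `rotW`, `rotW_mem_saLoops : ω ∈ saLoops N → rotW ω ∈ saLoops N`, `rotW_injective`, `rotW_rotW_rotW`;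
* `rowCount N ω` (distinct rows among the sites `ω 0, …, ω (N−1)`), `IsYTall N ω` (the rows dominate both rotated row counts), `tallLoops N`;
* **`le_two_mul_rowCount_mul : N ≤ 2 · rowCount N ω · rowCount N (rotW ω)`** for `ω` injective on `[0, N)`, hence
  **`le_two_mul_sq_rowCount : N ≤ 2 · (rowCount N ω)²`** for `Y`-tall loops;
* **`card_saLoops_le_three_mul_tall : #saLoops N ≤ 3 · #tallLoops N`** (Madras' S1 on `ℍ`, rooted form).
Class level:
* `rowCounts_eq_of_image_eq` (the three zigzag counts depend only on the site set up to even translation), `isYTall_unroot_iff`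
  (tallness is invariant under the tree's unrooting `(P, r, b) ↦ unroot N (P, r, b)` inside the brick wall);
* `tallReps N := {P ∈ polygonReps 2 N : IsBW N P ∧ IsYTall N P}`, **`card_tallLoops_le : #tallLoops N ≤ N · #tallReps N`**,
  **`hexPolygonNumber_le_three_mul_card_tallReps (hN : 3 ≤ N) : q_N(ℍ) ≤ 3 · #tallReps N`**;
* `tallCanon n := {ω ∈ canonEnd n : IsYTall (n+1) ω}`, **`card_canonEnd_le_three_mul_tall (hn : 2 ≤ n) : #canonEnd n ≤ 3 · #tallCanon n`** and
  **`le_two_mul_sq_rowCount_of_mem_tallCanon : ω ∈ tallCanon n → n + 1 ≤ 2 · (rowCount (n+1) ω)²`** — the two inputs a join count S5ℍ on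
  `canonEnd` consumes.

Printed anchors: [cite: Hammond2015SAPJoining, Definition 4.8 and Lemma 4.9 (arXiv v5 pp. 24–25: h(φ) ≥ w(φ) for at least half of SAP_n, by
right-angled rotation; h(φ) ≥ n^{1/2})] [cite: Madras1995LatticeAnimalsExponent, §2 (primary; not held by the lane)]
[cite: MadrasSlade1993, §3.2 eq. (3.2.1) p. 63 and Definition 3.2.2 (classes up to translation, re-rooting)].  Label (lane, lit-1 g16 on the
rooted part, 2026-08-24): CONSOLIDATION-BY-TRANSFER — ℍ edition: one third, by the 3-fold rotation (as the tree's 𝕋 file).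
-/

noncomputable section

open Finset Function Literature.Probability.LatticeModels Literature.Probability.Percolation SimpleGraph

namespace Literature.Probability.RandomPlanarGeometry.SAW

namespace HexBW

/-! ### The rotation by `120°` in brick-wall coordinates -/

section Rotation

/-- coordinates of a literal site. [folklore] -/
@[simp] private theorem vc0 (a b : ℤ) : (![a, b] : Site 2) 0 = a := rfl
/-- coordinates of a literal site. [folklore] -/
@[simp] private theorem vc1 (a b : ℤ) : (![a, b] : Site 2) 1 = b := rfl

/-- **The order-3 rotation of the honeycomb lattice about the origin vertex, in brick-wall coordinates**:
`ρ(x, y) = (⌊(x+y)/2⌋ + 2⌊(y−x)/2⌋ + ((x+y) mod 2), −⌊(x+y)/2⌋)` (`= hvToBW ∘ HV.rho ∘ bwToHV`: the up vertex `(a, b)` goes to `(b, −a−b)`, the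
down vertex `(a, b)` to `(b, −a−b−1)`).
[cite: Beaton2014RotatedHoneycomb, §2 (Fig. 1: the rotated honeycomb lattice); EntingJensen2009, §7.4.2, Fig. 7.10 (brickwork form of the honeycomb lattice); lane plumbing, not in print] -/
def bwRot (x : Site 2) : Site 2 :=
  ![(x 0 + x 1) / 2 + 2 * ((x 1 - x 0) / 2) + (x 0 + x 1) % 2, -((x 0 + x 1) / 2)]

/-- first coordinate of `bwRot`. [cite: EntingJensen2009, §7.4.2, Fig. 7.10 (brickwork form of the honeycomb lattice); lane plumbing, not in print] -/
@[simp] theorem bwRot_apply_zero (x : Site 2) :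
    bwRot x 0 = (x 0 + x 1) / 2 + 2 * ((x 1 - x 0) / 2) + (x 0 + x 1) % 2 := rfl

/-- **the row of the rotated site is `−⌊(x+y)/2⌋`** (the second zigzag coordinate). [cite: EntingJensen2009, §7.4.2, Fig. 7.10 (brickwork form of the honeycomb lattice); lane plumbing, not in print] -/
@[simp] theorem bwRot_apply_one (x : Site 2) : bwRot x 1 = -((x 0 + x 1) / 2) := rfl

/-- `ρ` fixes the origin. [cite: Beaton2014RotatedHoneycomb, §2 (Fig. 1); lane plumbing, not in print] -/
theorem bwRot_zero : bwRot 0 = 0 := by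
  rw [site_two_eq_iff, bwRot_apply_zero, bwRot_apply_one]
  simp

/-- **`ρ` is a graph endomorphism of the brick wall** (hence an automorphism, being a bijection). [cite: Beaton2014RotatedHoneycomb, §2 (Fig. 1: the rotation is a lattice symmetry); lane plumbing, not in print] -/
theorem bwRot_adj {x y : Site 2} (h : brickWallGraph.Adj x y) : brickWallGraph.Adj (bwRot x) (bwRot y) := by
  rw [brickWallGraph_adj_coord] at h ⊢
  simp only [bwRot_apply_zero, bwRot_apply_one]
  omega

/-- **`ρ³ = 1`.** [cite: Beaton2014RotatedHoneycomb, §2 (Fig. 1); lane plumbing, not in print] -/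
theorem bwRot_bwRot_bwRot (x : Site 2) : bwRot (bwRot (bwRot x)) = x := by
  rw [site_two_eq_iff]
  simp only [bwRot_apply_zero, bwRot_apply_one]
  omega

/-- `ρ` is injective. [cite: Beaton2014RotatedHoneycomb, §2 (Fig. 1); lane plumbing, not in print] -/
theorem bwRot_injective : Injective bwRot := fun x y h => by
  have := congrArg (fun z => bwRot (bwRot z)) h
  simpa only [bwRot_bwRot_bwRot] using this

/-- **Two zigzag coordinates determine the site up to its parity class**: sites with the same row, the same rotated row and the same
parity of `x + y` are equal (so a row and a rotated row meet in at most two sites). [cite: Madras1995LatticeAnimalsExponent, §2 (the sites lie in a box; primary, not held by the lane); lane plumbing, not in print] -/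
theorem eq_of_rows_eq {x y : Site 2} (h1 : x 1 = y 1) (h2 : bwRot x 1 = bwRot y 1)
    (h3 : (x 0 + x 1) % 2 = (y 0 + y 1) % 2) : x = y := by
  rw [bwRot_apply_one, bwRot_apply_one] at h2
  rw [site_two_eq_iff]
  omega

end Rotation

/-! ### Rotating rooted loops -/

section Loops

variable {N : ℕ} {ω : ℕ → Site 2}

/-- The rotated walk `i ↦ ρ(ω i)`. [cite: Hammond2015SAPJoining, Definition 4.8 (arXiv v5 p. 24: rotation of a polygon); lane plumbing] -/
def rotW (ω : ℕ → Site 2) : ℕ → Site 2 := fun i => bwRot (ω i)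

/-- value of the rotated walk. [cite: Hammond2015SAPJoining, Definition 4.8 (arXiv v5 p. 24); lane plumbing] -/
@[simp] theorem rotW_apply (ω : ℕ → Site 2) (i : ℕ) : rotW ω i = bwRot (ω i) := rfl

/-- `rotW³ = 1`. [cite: Beaton2014RotatedHoneycomb, §2 (Fig. 1); lane plumbing] -/
theorem rotW_rotW_rotW (ω : ℕ → Site 2) : rotW (rotW (rotW ω)) = ω :=
  funext fun i => bwRot_bwRot_bwRot (ω i)

/-- `rotW` is injective. [cite: Beaton2014RotatedHoneycomb, §2 (Fig. 1); lane plumbing] -/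
theorem rotW_injective : Injective rotW := fun ω ω' h =>
  funext fun i => bwRot_injective (by simpa only [rotW_apply] using congrFun h i)

/-- Rotation preserves brick-wall walks. [cite: Beaton2014RotatedHoneycomb, §2 (Fig. 1); lane plumbing] -/
theorem isBW_rotW {n : ℕ} (h : IsBW n ω) : IsBW n (rotW ω) := fun i hi => bwRot_adj (h i hi)

/-- **Rotation acts on the rooted oriented self-avoiding loops of `ℍ` at `0`.**
[cite: MadrasSlade1993, §3.2 p. 63 (rooted oriented polygons); Hammond2015SAPJoining, Definition 4.8 (arXiv v5 p. 24)] -/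
theorem rotW_mem_saLoops (h : ω ∈ saLoops N) : rotW ω ∈ saLoops N := by
  rw [mem_saLoops] at h ⊢
  obtain ⟨hZ, hBW⟩ := h
  obtain ⟨h0, hfr, -, hN, hinj⟩ := Zd.PolygonConcat.mem_saLoops_iff.1 hZ
  refine ⟨Zd.PolygonConcat.mem_saLoops_iff.2 ⟨?_, ?_, ?_, ?_, ?_⟩, isBW_rotW hBW⟩
  · rw [rotW_apply, h0, bwRot_zero]
  · intro i hi
    rw [rotW_apply, rotW_apply, hfr i hi]
  · intro i hi
    exact brickWallGraph_le (bwRot_adj (hBW i hi))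
  · rw [rotW_apply, hN, bwRot_zero]
  · intro i hi j hj hij
    exact hinj hi hj (bwRot_injective hij)

end Loops

/-! ### Zigzag counts and tall loops -/

section Counts

variable {N : ℕ} {ω : ℕ → Site 2}

open Classical in
/-- Number of distinct rows `y` among the sites `ω 0, …, ω (N−1)`. [cite: Madras1995LatticeAnimalsExponent, §2 (height of a polygon; primary, not held by the lane); Hammond2015SAPJoining, Definition 4.8 (arXiv v5 p. 24: height h(φ))] -/
def rowCount (N : ℕ) (ω : ℕ → Site 2) : ℕ := #((range N).image fun i => ω i 1)

/-- **`Y`-tall**: the row count dominates the row counts of both rotated copies (the largest of the three zigzag extents is along the rows).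
[cite: Hammond2015SAPJoining, Definition 4.8 (arXiv v5 p. 24: "h(φ) ≥ w(φ)"); Madras1995LatticeAnimalsExponent, §2 (primary, not held by the lane)] -/
def IsYTall (N : ℕ) (ω : ℕ → Site 2) : Prop :=
  rowCount N (rotW ω) ≤ rowCount N ω ∧ rowCount N (rotW (rotW ω)) ≤ rowCount N ω

open Classical in
/-- The `Y`-tall rooted loops. [cite: Hammond2015SAPJoining, Definition 4.8 (arXiv v5 p. 24); Madras1995LatticeAnimalsExponent, §2 (primary, not held by the lane)] -/
def tallLoops (N : ℕ) : Finset (ℕ → Site 2) := (saLoops N).filter fun ω => IsYTall N ω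

/-- membership in `tallLoops`. [cite: Hammond2015SAPJoining, Definition 4.8 (arXiv v5 p. 24)] -/
theorem mem_tallLoops : ω ∈ tallLoops N ↔ ω ∈ saLoops N ∧ IsYTall N ω := by
  classical
  rw [tallLoops, Finset.mem_filter]

/-- **A row and a rotated row meet in at most two sites**: `N ≤ 2 · rowCount N ω · rowCount N (ρω)` for `ω` injective on `[0, N)`.
[cite: Madras1995LatticeAnimalsExponent, §2 (the sites lie in a box; primary, not held by the lane); Hammond2015SAPJoining, Definition 4.8 (arXiv v5 p. 24: "h(φ) ≥ w(φ) (and thus, by a trivial argument, h(φ) ≥ n^{1/2})")] -/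
theorem le_two_mul_rowCount_mul (hinj : Set.InjOn ω {i | i < N}) :
    N ≤ 2 * (rowCount N ω * rowCount N (rotW ω)) := by
  classical
  have hP : #(({0, 1} : Finset ℤ)) = 2 := by decide
  have key : N ≤ #((((range N).image fun i => ω i 1) ×ˢ ((range N).image fun i => rotW ω i 1)) ×ˢ
      ({0, 1} : Finset ℤ)) := by
    calc N = #(range N) := (Finset.card_range _).symm
      _ ≤ _ := Finset.card_le_card_of_injOn (fun i => ((ω i 1, rotW ω i 1), (ω i 0 + ω i 1) % 2))
          (fun i hi => ?_) (fun i hi j hj h => ?_)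
    · rw [Finset.mem_coe] at hi
      rw [Finset.mem_coe, Finset.mem_product, Finset.mem_product]
      refine ⟨⟨Finset.mem_image.2 ⟨i, hi, rfl⟩, Finset.mem_image.2 ⟨i, hi, rfl⟩⟩, ?_⟩
      have : (ω i 0 + ω i 1) % 2 = 0 ∨ (ω i 0 + ω i 1) % 2 = 1 := by omega
      rcases this with h | h <;> simp [h]
    · rw [Finset.mem_coe, Finset.mem_range] at hi hj
      simp only [Prod.mk.injEq] at h
      exact hinj hi hj (eq_of_rows_eq h.1.1 h.1.2 h.2)
  rw [Finset.card_product, Finset.card_product, hP] at key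
  unfold rowCount
  calc N ≤ _ := key
    _ = _ := by ring

/-- **Tall loops occupy at least `√(N/2)` rows**: `N ≤ 2 · (rowCount N ω)²` for a `Y`-tall loop of `saLoops N`.
[cite: Hammond2015SAPJoining, Definition 4.8 (arXiv v5 p. 24: "h(φ) ≥ n^{1/2}"); Madras1995LatticeAnimalsExponent, §2 (primary, not held by the lane)] -/
theorem le_two_mul_sq_rowCount (hω : ω ∈ saLoops N) (ht : IsYTall N ω) : N ≤ 2 * rowCount N ω ^ 2 := by
  have hinj := (Zd.PolygonConcat.mem_saLoops_iff.1 (mem_saLoops.1 hω).1).2.2.2.2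
  calc N ≤ 2 * (rowCount N ω * rowCount N (rotW ω)) := le_two_mul_rowCount_mul hinj
    _ ≤ 2 * (rowCount N ω * rowCount N ω) := Nat.mul_le_mul_left 2 (Nat.mul_le_mul_left _ ht.1)
    _ = 2 * rowCount N ω ^ 2 := by rw [sq]

/-- One of `ω`, `ρω`, `ρ²ω` is `Y`-tall (the three zigzag counts are permuted cyclically by `ρ`, and one of them is the largest).
[cite: Hammond2015SAPJoining, Lemma 4.9 (arXiv v5 pp. 24–25: the rotation argument); Madras1995LatticeAnimalsExponent, §2 (primary, not held by the lane)] -/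
theorem isYTall_or (N : ℕ) (ω : ℕ → Site 2) : IsYTall N ω ∨ IsYTall N (rotW ω) ∨ IsYTall N (rotW (rotW ω)) := by
  unfold IsYTall
  simp only [rotW_rotW_rotW]
  omega

/-- **«Tall third» on `ℍ` (rooted form)**: at least a third of the rooted oriented self-avoiding `N`-loops of the honeycomb lattice are
`Y`-tall, `#saLoops N ≤ 3 · #tallLoops N` — the three sets `{ω : ρ^k ω is Y-tall}`, `k = 0, 1, 2`, cover `saLoops N` and each injects into
`tallLoops N` by `ρ^k`.
[cite: Hammond2015SAPJoining, Lemma 4.9 (arXiv v5 pp. 24–25: h(φ) ≥ w(φ) for at least half of SAP_n, by right-angled rotation — here a third, by the rotation of order 3); Madras1995LatticeAnimalsExponent, §2 (primary, not held by the lane)] -/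
theorem card_saLoops_le_three_mul_tall (N : ℕ) : #(saLoops N) ≤ 3 * #(tallLoops N) := by
  classical
  set T := tallLoops N with hT
  set A₁ := (saLoops N).filter fun ω => IsYTall N (rotW ω) with hA₁
  set A₂ := (saLoops N).filter fun ω => IsYTall N (rotW (rotW ω)) with hA₂
  have hcover : saLoops N ⊆ T ∪ A₁ ∪ A₂ := by
    intro ω hω
    rcases isYTall_or N ω with h | h | h
    · exact Finset.mem_union_left _ (Finset.mem_union_left _ (mem_tallLoops.2 ⟨hω, h⟩))
    · exact Finset.mem_union_left _ (Finset.mem_union_right _ (Finset.mem_filter.2 ⟨hω, h⟩))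
    · exact Finset.mem_union_right _ (Finset.mem_filter.2 ⟨hω, h⟩)
  have h1 : #A₁ ≤ #T := by
    refine Finset.card_le_card_of_injOn rotW (fun ω hω => ?_) (fun _ _ _ _ h => rotW_injective h)
    rw [Finset.mem_coe, hA₁, Finset.mem_filter] at hω
    rw [Finset.mem_coe, mem_tallLoops]
    exact ⟨rotW_mem_saLoops hω.1, hω.2⟩
  have h2 : #A₂ ≤ #T := by
    refine Finset.card_le_card_of_injOn (fun ω => rotW (rotW ω)) (fun ω hω => ?_)
      (fun _ _ _ _ h => rotW_injective (rotW_injective h))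
    rw [Finset.mem_coe, hA₂, Finset.mem_filter] at hω
    rw [Finset.mem_coe, mem_tallLoops]
    exact ⟨rotW_mem_saLoops (rotW_mem_saLoops hω.1), hω.2⟩
  calc #(saLoops N) ≤ #(T ∪ A₁ ∪ A₂) := Finset.card_le_card hcover
    _ ≤ #(T ∪ A₁) + #A₂ := Finset.card_union_le _ _
    _ ≤ #T + #A₁ + #A₂ := Nat.add_le_add_right (Finset.card_union_le _ _) _
    _ ≤ 3 * #T := by omega

end Counts
/-! ### Even translations and the zigzag counts -/

section Even

variable {N : ℕ} {ω P : ℕ → Site 2}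

/-- **`ρ` is affine on the even sublattice**: `ρ(x + t) = ρ(x) + ρ(t)` when `t₀ + t₁` is even.
[cite: Beaton2014RotatedHoneycomb, §2 (Fig. 1: the rotation is a lattice symmetry); lane plumbing, not in print] -/
theorem bwRot_add_of_even (x : Site 2) {t : Site 2} (ht : (t 0 + t 1) % 2 = 0) : bwRot (x + t) = bwRot x + bwRot t := by
  rw [site_two_eq_iff]
  simp only [bwRot_apply_zero, bwRot_apply_one, Pi.add_apply]
  omega

/-- `ρ` maps even sites to even sites. [cite: Beaton2014RotatedHoneycomb, §2 (Fig. 1); lane plumbing, not in print] -/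
theorem even_bwRot {t : Site 2} (ht : (t 0 + t 1) % 2 = 0) : (bwRot t 0 + bwRot t 1) % 2 = 0 := by
  simp only [bwRot_apply_zero, bwRot_apply_one]
  omega

/-- Translating a finite set of integers does not change its size. [folklore] -/
private theorem card_image_add_const (S : Finset (Site 2)) (φ : Site 2 → ℤ) (c : ℤ) :
    #(S.image fun x => φ x + c) = #(S.image φ) := by
  classical
  rw [show (fun x => φ x + c) = (fun z : ℤ => z + c) ∘ φ from rfl, ← Finset.image_image]
  exact Finset.card_image_of_injective _ (add_left_injective c)

/-- **The three zigzag counts depend only on the site set up to an even translation.**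
[cite: Madras1995LatticeAnimalsExponent, §2 (height and width are class functions; primary, not held by the lane); Hammond2015SAPJoining, Definition 4.8 (arXiv v5 p. 24)] -/
theorem rowCounts_eq_of_image_eq {t : Site 2} (ht : (t 0 + t 1) % 2 = 0)
    (h : (range N).image ω = ((range N).image P).image fun x => x + t) :
    rowCount N ω = rowCount N P ∧ rowCount N (rotW ω) = rowCount N (rotW P) ∧
      rowCount N (rotW (rotW ω)) = rowCount N (rotW (rotW P)) := by
  classical
  have key : ∀ φ : Site 2 → ℤ, (∃ c : ℤ, ∀ x, φ (x + t) = φ x + c) →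
      #((range N).image fun i => φ (ω i)) = #((range N).image fun i => φ (P i)) := by
    rintro φ ⟨c, hc⟩
    rw [show (fun i => φ (ω i)) = φ ∘ ω from rfl, ← Finset.image_image, h, Finset.image_image,
      show φ ∘ (fun x => x + t) = fun x => φ x + c from funext fun x => hc x, card_image_add_const,
      show (fun i => φ (P i)) = φ ∘ P from rfl, ← Finset.image_image]
  unfold rowCount
  refine ⟨key (fun x => x 1) ⟨t 1, fun x => rfl⟩, key (fun x => bwRot x 1) ⟨bwRot t 1, fun x => ?_⟩,
    key (fun x => bwRot (bwRot x) 1) ⟨bwRot (bwRot t) 1, fun x => ?_⟩⟩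
  · simp only [bwRot_add_of_even x ht, Pi.add_apply]
  · simp only [bwRot_add_of_even x ht, bwRot_add_of_even (bwRot x) (even_bwRot ht), Pi.add_apply]

/-- Hence tallness depends only on the site set up to an even translation. [cite: Hammond2015SAPJoining, Definition 4.8 (arXiv v5 p. 24)] -/
theorem isYTall_iff_of_image_eq {t : Site 2} (ht : (t 0 + t 1) % 2 = 0)
    (h : (range N).image ω = ((range N).image P).image fun x => x + t) : IsYTall N ω ↔ IsYTall N P := by
  obtain ⟨h1, h2, h3⟩ := rowCounts_eq_of_image_eq ht h
  unfold IsYTall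
  rw [h1, h2, h3]

end Even

/-! ### The site set of an unrooting -/

section Unroot

variable {N : ℕ} {P : ℕ → Site 2}

/-- `s ↦ (r + s) mod N` permutes `[0, N)`. [folklore] -/
private theorem image_add_mod (hN : 0 < N) (r : ℕ) : (range N).image (fun s => (r + s) % N) = range N := by
  classical
  apply Finset.eq_of_subset_of_card_le
  · intro j hj
    rw [Finset.mem_image] at hj
    obtain ⟨s, -, rfl⟩ := hj
    exact Finset.mem_range.2 (Nat.mod_lt _ hN)
  · rw [Finset.card_image_of_injOn, Finset.card_range]
    intro s hs s' hs' h
    rw [Finset.mem_coe, Finset.mem_range] at hs hs'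
    simp only at h
    have h1 := Nat.sub_mod_eq_zero_of_mod_eq h
    have h2 := Nat.sub_mod_eq_zero_of_mod_eq h.symm
    rcases le_total s s' with hle | hle
    · rw [show r + s' - (r + s) = s' - s by omega] at h2
      have := Nat.eq_zero_of_dvd_of_lt (Nat.dvd_of_mod_eq_zero h2) (by omega)
      omega
    · rw [show r + s - (r + s') = s - s' by omega] at h1
      have := Nat.eq_zero_of_dvd_of_lt (Nat.dvd_of_mod_eq_zero h1) (by omega)
      omega

/-- The site set of a re-rooted loop is a translate of the original site set.
[cite: MadrasSlade1993, §3.2 eq. (3.2.1) p. 63 (re-rooting)] -/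
theorem image_rotLoop (hN : 0 < N) {r : ℕ} (Q : ℕ → Site 2) :
    (range N).image (Zd.PolygonConcat.rotLoop N r Q) = ((range N).image Q).image fun x => x + -Q r := by
  classical
  have h1 : (range N).image (Zd.PolygonConcat.rotLoop N r Q) = (range N).image (fun s => Q ((r + s) % N) + -Q r) := by
    apply Finset.image_congr
    intro s hs
    rw [Finset.mem_coe, Finset.mem_range] at hs
    rw [Zd.PolygonConcat.rotLoop_apply_of_le hs.le, sub_eq_add_neg]
  rw [h1, show (fun s => Q ((r + s) % N) + -Q r) = (fun x => x + -Q r) ∘ Q ∘ (fun s => (r + s) % N) from rfl,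
    ← Finset.image_image, ← Finset.image_image, image_add_mod hN]

/-- The site set of the reversed loop is the same site set (for a loop: `Q N = Q 0`).
[cite: MadrasSlade1993, §3.2 eq. (3.2.1) p. 63 ("either of two directions")] -/
theorem image_revLoop (hN : 0 < N) (Q : ℕ → Site 2) (hQ : Q N = Q 0) :
    (range N).image (Zd.PolygonConcat.revLoop N Q) = (range N).image Q := by
  classical
  ext x
  simp only [Finset.mem_image, Finset.mem_range]
  constructor
  · rintro ⟨s, hs, rfl⟩
    rw [Zd.PolygonConcat.revLoop_apply_of_le hs.le]
    by_cases h0 : s = 0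
    · exact ⟨0, hN, by rw [h0, Nat.sub_zero, hQ]⟩
    · exact ⟨N - s, by omega, rfl⟩
  · rintro ⟨j, hj, rfl⟩
    by_cases h0 : j = 0
    · exact ⟨0, hN, by rw [Zd.PolygonConcat.revLoop_apply_of_le (Nat.zero_le _), Nat.sub_zero, hQ, h0]⟩
    · exact ⟨N - j, by omega, by rw [Zd.PolygonConcat.revLoop_apply_of_le (by omega), show N - (N - j) = j by omega]⟩

/-- **Tallness is invariant under unrooting** (inside the brick wall): for `(P, r, b)` in the unrooting domain with `unroot N (P, r, b)` a
honeycomb loop, `IsYTall N (unroot N (P, r, b)) ↔ IsYTall N P` — the root `P r` (or `P (N−r)`) is an even site.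
[cite: MadrasSlade1993, §3.2 eq. (3.2.1) p. 63 (re-rooting); Madras1995LatticeAnimalsExponent, §2 (height/width are class functions; primary, not held by the lane)] -/
theorem isYTall_unroot_iff (hN : 3 ≤ N) {x : (ℕ → Site 2) × ℕ × Bool} (hx : x ∈ Zd.PolygonConcat.unrootDom 2 N)
    (hbw : IsBW N (Zd.PolygonConcat.unroot N x)) : IsYTall N (Zd.PolygonConcat.unroot N x) ↔ IsYTall N x.1 := by
  classical
  obtain ⟨P, r, b⟩ := x
  obtain ⟨hP, hr⟩ := Zd.PolygonConcat.mem_unrootDom.1 hx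
  simp only at hP hr ⊢
  have hPs := Zd.PolygonConcat.mem_saLoops_of_mem_polygonReps hP
  have hN0 : 0 < N := by omega
  -- the root index is even
  have hre : r % 2 = 0 := by
    rcases (isBW_unroot_iff hx).1 hbw with ⟨-, h⟩ | ⟨h, -⟩
    · exact h
    · exact absurd h (PolygonConcat.not_isBWShift_e0_of_mem_polygonReps hN hP)
  set Q := Zd.PolygonConcat.orient N b P with hQ
  have hQs : Q ∈ Zd.saLoops 2 N := Zd.PolygonConcat.orient_mem_saLoops hPs b
  obtain ⟨hQ0, -, -, hQN, -⟩ := Zd.PolygonConcat.mem_saLoops_iff.1 hQs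
  -- the translation vector `−Q r` is even
  have hpar : (Q r 0 + Q r 1) % 2 = (r : ℤ) % 2 := parity_of_mem_zdSaLoops hQs hr.le
  have ht : ((-Q r : Site 2) 0 + (-Q r : Site 2) 1) % 2 = 0 := by
    simp only [Pi.neg_apply]; omega
  -- the site sets
  have hQP : (range N).image Q = (range N).image P := by
    rw [hQ, Zd.PolygonConcat.orient_eq]
    split_ifs
    · obtain ⟨hP0, -, -, hPN, -⟩ := Zd.PolygonConcat.mem_saLoops_iff.1 hPs
      exact image_revLoop hN0 P (by rw [hPN, hP0])
    · rfl
  have himg : (range N).image (Zd.PolygonConcat.unroot N (P, r, b)) = ((range N).image P).image fun x => x + -Q r := by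
    rw [show Zd.PolygonConcat.unroot N (P, r, b) = Zd.PolygonConcat.rotLoop N r Q from rfl, image_rotLoop hN0, hQP]
  exact isYTall_iff_of_image_eq ht himg

end Unroot

/-! ### The tall third for the classes `polygonReps 2 N ∩ IsBW` -/

section Classes

variable {N : ℕ}

open Classical in
/-- The tall `ℤ²`-canonical representatives lying in the brick wall (one per tall honeycomb class).
[cite: MadrasSlade1993, Definition 3.2.2, p. 63; Hammond2015SAPJoining, Definition 4.8 (arXiv v5 p. 24)] -/
def tallReps (N : ℕ) : Finset (ℕ → Site 2) :=
  (Zd.PolygonConcat.polygonReps 2 N).filter fun P => IsBW N P ∧ IsYTall N P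

/-- membership in `tallReps`. [cite: Hammond2015SAPJoining, Definition 4.8 (arXiv v5 p. 24)] -/
theorem mem_tallReps {P : ℕ → Site 2} : P ∈ tallReps N ↔ P ∈ Zd.PolygonConcat.polygonReps 2 N ∧ IsBW N P ∧ IsYTall N P := by
  classical
  rw [tallReps, Finset.mem_filter]

/-- Half of `[0, 2k)` is even. [folklore] -/
private theorem card_range_filter_even (k : ℕ) : #((range (2 * k)).filter fun r => r % 2 = 0) = k := by
  induction k with
  | zero => simp
  | succ k ih =>
    rw [show 2 * (k + 1) = 2 * k + 1 + 1 by ring, Finset.range_add_one, Finset.range_add_one, Finset.filter_insert,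
      Finset.filter_insert, if_neg (by omega), if_pos (by omega), Finset.card_insert_of_notMem (by simp), ih]

/-- **Each tall class has at most `N` tall rooted traversals in the brick wall**: `#tallLoops N ≤ N · #tallReps N` (`N ≥ 3`; the
unrootings `(P, r, b)` of a honeycomb loop have `P` in the brick wall and `r` even, and tallness passes to `P`).
[cite: MadrasSlade1993, §3.2 eq. (3.2.1) p. 63 (2N rooted oriented traversals per class; here N inside the brick wall)] -/
theorem card_tallLoops_le (hN : 3 ≤ N) : #(tallLoops N) ≤ N * #(tallReps N) := by
  classical
  rcases Nat.even_or_odd N with ⟨k, hk⟩ | hodd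
  swap
  · -- odd `N`: there are no honeycomb `N`-loops at all
    have h0 : #(tallLoops N) ≤ N * hexPolygonNumber N := by
      rw [← card_saLoops_eq_mul_hexPolygonNumber hN]
      exact Finset.card_le_card fun ω hω => (mem_tallLoops.1 hω).1
    rw [hexPolygonNumber_eq_zero_of_odd hN hodd, mul_zero] at h0
    omega
  -- tall loops as a filter of the `ℤ²` loops, counted through the unrooting domain
  have h1 : tallLoops N = (Zd.saLoops 2 N).filter fun ω => IsBW N ω ∧ IsYTall N ω := by
    ext ω; rw [mem_tallLoops, mem_saLoops, Finset.mem_filter, and_assoc]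
  rw [h1, Zd.PolygonConcat.card_filter_saLoops_eq hN]
  -- the unrootings landing in tall honeycomb loops have a tall brick-wall representative and an even root index
  set E := (range N).filter fun r => r % 2 = 0 with hE
  have hsub : ((Zd.PolygonConcat.unrootDom 2 N).filter fun x =>
      IsBW N (Zd.PolygonConcat.unroot N x) ∧ IsYTall N (Zd.PolygonConcat.unroot N x)) ⊆
      tallReps N ×ˢ (E ×ˢ (Finset.univ : Finset Bool)) := by
    intro x hx
    rw [Finset.mem_filter] at hx
    obtain ⟨hxD, hbw, htall⟩ := hx
    obtain ⟨hP, hr⟩ := Zd.PolygonConcat.mem_unrootDom.1 hxD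
    have hcase : IsBW N x.1 ∧ x.2.1 % 2 = 0 := by
      rcases (isBW_unroot_iff hxD).1 hbw with h | ⟨h, -⟩
      · exact h
      · exact absurd h (PolygonConcat.not_isBWShift_e0_of_mem_polygonReps hN hP)
    rw [Finset.mem_product, Finset.mem_product, mem_tallReps, hE, Finset.mem_filter, Finset.mem_range]
    exact ⟨⟨hP, hcase.1, (isYTall_unroot_iff hN hxD hbw).1 htall⟩, ⟨hr, hcase.2⟩, Finset.mem_univ _⟩
  refine (Finset.card_le_card hsub).trans ?_
  have hEcard : #E = k := by
    rw [hE, show N = 2 * k by omega, card_range_filter_even]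
  rw [Finset.card_product, Finset.card_product, Finset.card_univ, Fintype.card_bool, hEcard]
  calc #(tallReps N) * (k * 2) = N * #(tallReps N) := by rw [show k * 2 = N by omega, mul_comm]
    _ ≤ N * #(tallReps N) := le_rfl

/-- **«Tall third» for honeycomb polygons up to translation**: `q_N(ℍ) ≤ 3 · #tallReps N` for `N ≥ 3` — at least a third of the
translation classes of `N`-step honeycomb polygons are `Y`-tall (`N · q_N = #saLoops N ≤ 3 · #tallLoops N ≤ 3N · #tallReps N`).
[cite: Hammond2015SAPJoining, Lemma 4.9 (arXiv v5 pp. 24–25: "|SAP^r_n| ≥ ½·|SAP_n| … by right-angled rotation" — here a third, by the rotation of order 3); Madras1995LatticeAnimalsExponent, §2 (primary; not held by the lane)] -/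
theorem hexPolygonNumber_le_three_mul_card_tallReps (hN : 3 ≤ N) : hexPolygonNumber N ≤ 3 * #(tallReps N) := by
  have h1 := card_saLoops_eq_mul_hexPolygonNumber hN
  have h2 := card_saLoops_le_three_mul_tall N
  have h3 := card_tallLoops_le hN
  have hN0 : 0 < N := by omega
  have : N * hexPolygonNumber N ≤ N * (3 * #(tallReps N)) := by
    calc N * hexPolygonNumber N = #(saLoops N) := h1.symm
      _ ≤ 3 * #(tallLoops N) := h2
      _ ≤ 3 * (N * #(tallReps N)) := Nat.mul_le_mul_left 3 h3
      _ = N * (3 * #(tallReps N)) := by ring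
  exact Nat.le_of_mul_le_mul_left this hN0

end Classes

/-! ### The tall third for the canonical traversals `canonEnd n` -/

section Canon

variable {n : ℕ} {ω : ℕ → Site 2}

open PolygonConcat

open Classical in
/-- The `Y`-tall canonical traversals (`canonEnd n`: the `(n+1)`-gons rooted at their lexicographically smallest site, first step up).
[cite: MadrasSlade1993, Definition 3.2.2 and §3.2 (proof of Theorem 3.2.3: `Q[N]`); Hammond2015SAPJoining, Definition 4.8 (arXiv v5 p. 24)] -/
def tallCanon (n : ℕ) : Finset (ℕ → Site 2) := (canonEnd n).filter fun ω => IsYTall (n + 1) ω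

/-- membership in `tallCanon`. [cite: Hammond2015SAPJoining, Definition 4.8 (arXiv v5 p. 24)] -/
theorem mem_tallCanon : ω ∈ tallCanon n ↔ ω ∈ canonEnd n ∧ IsYTall (n + 1) ω := by
  classical
  rw [tallCanon, Finset.mem_filter]

/-- Freezing a brick-wall representative at time `n` gives a canonical traversal (the map of `card_canonEnd`).
[cite: MadrasSlade1993, Definition 3.2.2 and §3.2 (proof of Theorem 3.2.3)] -/
theorem freeze_mem_canonEnd (hn : 2 ≤ n) {P : ℕ → Site 2} (hP : P ∈ Zd.PolygonConcat.polygonReps 2 (n + 1)) (hbw : IsBW (n + 1) P) :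
    (fun i => P (min i n)) ∈ canonEnd n := by
  obtain ⟨h1, hpred⟩ := apply_pred_of_mem_polygonReps (by omega) hP hbw
  have hs := Zd.PolygonConcat.mem_saLoops_of_mem_polygonReps hP
  have hlex : ∀ i < n + 1, toLex (0 : Site 2) ≤ toLex (P i) := by
    classical
    have := (Finset.mem_filter.1 hP).1
    rw [Zd.PolygonConcat.canonLoops, Finset.mem_filter] at this
    exact this.2
  obtain ⟨h0, -, -, -, hinj⟩ := Zd.PolygonConcat.mem_saLoops_iff.1 hs
  rw [mem_canonEnd, mem_endAt_iff]
  refine ⟨⟨⟨by simp [h0], fun i hi => by simp [min_eq_right hi], fun i hi => ?_, fun i hi j hj hij => ?_⟩, ?_⟩, fun i hi => ?_⟩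
  · simp only [min_eq_left hi.le, min_eq_left (Nat.succ_le_of_lt hi)]; exact hbw i (by omega)
  · simp only [Set.mem_setOf_eq] at hi hj
    simp only [min_eq_left hi, min_eq_left hj] at hij
    exact hinj (show i < n + 1 by simpa using Nat.lt_succ_of_le hi) (show j < n + 1 by simpa using Nat.lt_succ_of_le hj) hij
  · simp only [min_self]; rw [show n = n + 1 - 1 by omega]; exact hpred
  · simp only [min_eq_left hi]; exact lexNonneg_iff.2 (hlex i (by omega))

/-- **«Tall third» for the canonical traversals**: `#canonEnd n ≤ 3 · #tallCanon n` for `n ≥ 2`.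
[cite: Hammond2015SAPJoining, Lemma 4.9 (arXiv v5 pp. 24–25); Madras1995LatticeAnimalsExponent, §2 (primary; not held by the lane)] -/
theorem card_canonEnd_le_three_mul_tall (hn : 2 ≤ n) : #(canonEnd n) ≤ 3 * #(tallCanon n) := by
  classical
  rw [card_canonEnd hn]
  refine (hexPolygonNumber_le_three_mul_card_tallReps (N := n + 1) (by omega)).trans (Nat.mul_le_mul_left 3 ?_)
  -- freeze the tall representatives: an injection `tallReps (n+1) → tallCanon n`
  refine Finset.card_le_card_of_injOn (fun P => fun i => P (min i n)) (fun P hP => ?_) (fun P hP P' hP' h => ?_)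
  · rw [Finset.mem_coe, mem_tallReps] at hP
    obtain ⟨hP, hbw, htall⟩ := hP
    rw [Finset.mem_coe, mem_tallCanon]
    refine ⟨freeze_mem_canonEnd hn hP hbw, ?_⟩
    -- same sites on `[0, n]`
    have himg : (range (n + 1)).image (fun i => P (min i n)) = ((range (n + 1)).image P).image fun x => x + 0 := by
      rw [Finset.image_image, show (fun x : Site 2 => x + 0) ∘ P = P from funext fun i => add_zero _]
      apply Finset.image_congr
      intro i hi
      rw [Finset.mem_coe, Finset.mem_range] at hi
      simp [min_eq_left (show i ≤ n by omega)]
    exact (isYTall_iff_of_image_eq (by simp) himg).2 htall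
  · rw [Finset.mem_coe, mem_tallReps] at hP hP'
    have hs := Zd.PolygonConcat.mem_saLoops_of_mem_polygonReps hP.1
    have hs' := Zd.PolygonConcat.mem_saLoops_of_mem_polygonReps hP'.1
    obtain ⟨-, hfr, -, hNz, -⟩ := Zd.PolygonConcat.mem_saLoops_iff.1 hs
    obtain ⟨-, hfr', -, hNz', -⟩ := Zd.PolygonConcat.mem_saLoops_iff.1 hs'
    funext i
    rcases le_or_gt i n with hi | hi
    · have := congrFun h i; simpa [min_eq_left hi] using this
    · rw [hfr i (by omega), hfr' i (by omega), hNz, hNz']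

/-- **A tall canonical traversal of an `(n+1)`-gon visits at least `√((n+1)/2)` rows**: `n + 1 ≤ 2 · (rowCount (n+1) ω)²`.
[cite: Hammond2015SAPJoining, Definition 4.8 (arXiv v5 p. 24: "h(φ) ≥ n^{1/2}"); Madras1995LatticeAnimalsExponent, §2 (primary; not held by the lane)] -/
theorem le_two_mul_sq_rowCount_of_mem_tallCanon (hω : ω ∈ tallCanon n) : n + 1 ≤ 2 * rowCount (n + 1) ω ^ 2 := by
  obtain ⟨hc, ht⟩ := mem_tallCanon.1 hω
  rw [mem_canonEnd, mem_endAt_iff] at hc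
  obtain ⟨⟨⟨-, -, -, hinj⟩, -⟩, -⟩ := hc
  have hinj' : Set.InjOn ω {i | i < n + 1} := fun i hi j hj h =>
    hinj (show i ∈ {i | i ≤ n} by simp at hi ⊢; omega) (show j ∈ {i | i ≤ n} by simp at hj ⊢; omega) h
  calc n + 1 ≤ 2 * (rowCount (n + 1) ω * rowCount (n + 1) (rotW ω)) := le_two_mul_rowCount_mul hinj'
    _ ≤ 2 * (rowCount (n + 1) ω * rowCount (n + 1) ω) := Nat.mul_le_mul_left 2 (Nat.mul_le_mul_left _ ht.1)
    _ = 2 * rowCount (n + 1) ω ^ 2 := by rw [sq]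

end Canon

end HexBW

end Literature.Probability.RandomPlanarGeometry.SAW

end
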